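import Literature.Computability.FineGrained.SchoeningCoinProgram
import Literature.Computability.FineGrained.SchoeningFourAlgorithm
import HarnessLib

/-!
# A biased-start Schöning walk for 4-SAT, machine I: lookups with a found flag, lookups in a second list

Topic `Literature/Computability/FineGrained`; first file of the machine half of the line
`SchoeningFour*` towards the named fact
`Literature.Computability.FineGrained.randSatExponent_four_lt_schoening`. The machine is a
structured stack program over `Γ'` (`SymbolPrograms.lean`) on the register file and store family
`SchoeningCoin.MSt` / `SchoeningCoin.st` of the Schöning machine (`SchoeningCoinRoutines.lean`), whose
routines (`scan`, `pick`, `coinTree`, `mkCy`, the walk loop) it reuses. This file adds the two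
lookups the new passes need:

* `lookupV` / `runs_lookupV` — the lookup pass of `IPRenameM.lookupVal` (`IPRenameLookup.lean`)
  without its normalisation: with the reversed index token `rbits ν` in the probe `pr` and a
  literal list `L` in `vt`, the register `val` receives `IPRenameM.valW L ν` — `[bit b]` if the
  first literal of `L` on `ν` has polarity `b`, `[]` if there is none — so that one lookup tells
  both whether `ν` is assigned (`valW_eq_nil_iff`: `SchoeningFour.memV`) and with which value;
* `lookupHV` / `runs_lookupHV` — the same lookup in the literal list held in the register `acc`
  (the selected variables of the greedy family), obtained by running `lookupV` with the registers
  `vt` and `acc` exchanged (`ACom.map` of a swap, `Runs.map`);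
* `pushLit b` / `runs_pushLit` — prepend the literal "variable of the probe := `b`" to `vt`.

## References

* T. Hofmeister, U. Schöning, R. Schuler, O. Watanabe, *A probabilistic 3-SAT algorithm further
  improved*, STACS 2002, LNCS 2285, 192–202, §3 (the algorithm whose machine this serves)
  [key `HofmeisterEtAl2002`].
* T. Nipkow, G. Klein, *Concrete Semantics with Isabelle/HOL*, Springer 2014, Ch. 7 (big-step
  reasoning, as in `SymbolPrograms.lean`).
-/

namespace Literature.Computability.FineGrained.SchoeningFour

open _root_.Computability Complexity Complexity.ACom IPRenameM Sparsifier SchoeningCoin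

/-! ### The answer of a lookup -/

/-- The answer `valW L ν` is empty iff `L` has no literal on `ν`. [folklore] -/
theorem valW_eq_nil_iff (L : List Lit) (ν : ℕ) : valW L ν = [] ↔ memV L ν = false := by
  unfold valW
  rw [memV_eq_isSome_find]
  cases L.find? (fun l => l.1 == ν) <;> simp

/-- The answer `valW L ν` when `L` has a literal on `ν`: the polarity of the first one. [folklore] -/
theorem valW_eq_of_find {L : List Lit} {ν : ℕ} {l : Lit} (h : L.find? (fun m => m.1 == ν) = some l) :
    valW L ν = [Γ'.bit l.2] := by
  unfold valW; rw [h]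

/-- The answer has at most one symbol. [folklore] -/
theorem length_valW_le (L : List Lit) (ν : ℕ) : (valW L ν).length ≤ 1 := by
  unfold valW; split <;> simp

/-! ### The lookup with its raw answer -/

/-- `lookupV`: the lookup pass of `IPRenameM.lookupVal` without normalisation — copy `vt`, scan the
copy entry by entry, lower the found flag; the answer `valW L ν` stays in `val`. [folklore] -/
def lookupV : RProg :=
  copyToG (tb TB.vt) (kr KR.vw) (kr KR.t1) (kr KR.t2) ;; loop (kr KR.vw) lvBody ;; clear (kr KR.fnd)

/-- **Specification of `lookupV`** over an arbitrary store: with `rbits ν` in `pr` and `cbody L` in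
`vt` (scratch registers empty), `val` becomes `valW L ν`, nothing else changes. [folklore] -/
theorem runs_lookupV (S : RStore) (ν : ℕ) (L : List Lit) (hpr : S (kr KR.pr) = rbits ν)
    (hvt : S (tb TB.vt) = cbody L) (hvw : S (kr KR.vw) = []) (hfnd : S (kr KR.fnd) = [])
    (hval : S (kr KR.val) = []) (hex : S (kr KR.ex) = []) (heb : S (kr KR.eb) = [])
    (hlmd : S (kr KR.lmd) = []) (hne : S (kr KR.ne) = []) (hx2 : S (kr KR.x2) = [])
    (ht1 : S (kr KR.t1) = []) (ht2 : S (kr KR.t2) = []) :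
    Runs lookupV S (Function.update S (kr KR.val) (valW L ν))
      ((12 * (rbits ν).length + 46) * (cbody L).length + 10) := by
  unfold lookupV
  have hS : S = lvSt S [] (fndW [] ν) (valW [] ν) [] [] [] [] := by
    funext r
    by_cases h1 : r = kr KR.vw; · subst h1; simp [hvw]
    by_cases h2 : r = kr KR.fnd; · subst h2; simp [hfnd, fndW, flagW]
    by_cases h3 : r = kr KR.val; · subst h3; simp [hval, valW]
    by_cases h4 : r = kr KR.ex; · subst h4; simp [hex]
    by_cases h5 : r = kr KR.eb; · subst h5; simp [heb]
    by_cases h6 : r = kr KR.lmd; · subst h6; simp [hlmd]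
    by_cases h7 : r = kr KR.ne; · subst h7; simp [hne]
    rw [lvSt_other _ _ _ _ _ _ _ _ h1 h2 h3 h4 h5 h6 h7]
  have h1 := runs_copyToG (a := tb TB.vt) (b := kr KR.vw) (t₁ := kr KR.t1) (t₂ := kr KR.t2)
    (by simp) (by simp) (by simp) (by simp) (by simp) (by simp) S ht1 ht2 hvw
  rw [hvt] at h1
  have h1' : Runs (copyToG (tb TB.vt) (kr KR.vw) (kr KR.t1) (kr KR.t2)) S
      (lvSt S (cbody L ++ []) (fndW [] ν) (valW [] ν) [] [] [] []) (10 * (cbody L).length + 3) := by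
    refine h1.of_eq ?_ le_rfl
    conv_lhs => rw [hS]
    rw [update_lvSt_vw, List.append_nil]
  have hL : L.length ≤ (cbody L).length := by
    clear h1 h1' hS hvt
    induction L with
    | nil => simp
    | cons a L ih => simp only [cbody_cons, List.length_cons, List.length_append]; omega
  have h2 := (segRuns_lvBody_cbody S ν hpr hx2 L [] []).runs_loop_nil (by simp)
  simp only [List.nil_append] at h2
  have h3 := runs_clear (kr KR.fnd) (lvSt S [] (fndW L ν) (valW L ν) [] [] [] [])
  simp only [lvSt_fnd, update_lvSt_fnd] at h3
  have hlenf : (fndW L ν).length ≤ 1 := length_flagW_le _ _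
  refine ((h1'.seq (h2.seq h3))).of_eq ?_ ?_
  · conv_rhs => rw [hS]
    rw [update_lvSt_val]
    have : fndW [] ν = [] := by simp [fndW, flagW]
    rw [this]
  · nlinarith [hL, hlenf]

/-- **`lookupV` on the program registers**: `val := valW L ν`. [folklore] -/
theorem runs_lookupV_st (ρ : MSt) (ν : ℕ) (L : List Lit) (hpr : ρ.pr = rbits ν) (hvt : ρ.vt = cbody L)
    (hval : ρ.val = []) (ht1 : ρ.t1 = []) (ht2 : ρ.t2 = []) :
    Runs lookupV (st ρ) (st { ρ with val := valW L ν }) ((12 * (rbits ν).length + 46) * (cbody L).length + 10) := by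
  have h := runs_lookupV (st ρ) ν L (by simp [hpr]) (by simp [hvt]) (by simp) (by simp) (by simp [hval]) (by simp)
    (by simp) (by simp) (by simp) (by simp) (by simp [ht1]) (by simp [ht2])
  simpa only [update_st_val] using h

/-! ### The lookup in the list of selected variables -/

/-- The exchange of the assignment register `vt` and the register `acc` of selected variables.
[folklore] -/
def swapVA : Reg ≃ Reg := Equiv.swap (tb TB.vt) (kr KR.hdr)

/-- `lookupHV`: `lookupV` with `vt` and `acc` exchanged — the lookup of the probe in the list of
selected variables. [folklore] -/
def lookupHV : RProg := lookupV.map swapVA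

/-- Grafting along a permutation is precomposition with its inverse. [folklore] -/
theorem graft_equiv {Γ ι : Type} (S : AStore Γ ι) (e : ι ≃ ι) (R' : AStore Γ ι) :
    graft S e R' = R' ∘ e.symm := by
  funext k
  obtain ⟨i, rfl⟩ := e.surjective k
  rw [graft_apply S e.injective, Function.comp_apply, Equiv.symm_apply_apply]

/-- The registers read through the exchange: `vt` reads `acc`, `acc` reads `vt`, the rest is
unchanged. [folklore] -/
theorem st_swapVA (ρ : MSt) (r : Reg) : st ρ (swapVA r) = st { ρ with vt := ρ.acc, acc := ρ.vt } r := by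
  unfold swapVA
  by_cases h1 : r = tb TB.vt
  · subst h1; simp [Equiv.swap_apply_left]
  · by_cases h2 : r = kr KR.hdr
    · subst h2; simp [Equiv.swap_apply_right]
    · rw [Equiv.swap_apply_of_ne_of_ne h1 h2]
      simp only [st]
      rw [if_neg h1, if_neg h2, if_neg h1, if_neg h2]

/-- **Specification of `lookupHV`**: with `rbits ν` in the probe `pr` and the literal list `Hs` of
the selected variables in `acc`, `val := valW Hs ν`; nothing else changes (`vt` arbitrary).
[folklore] -/
theorem runs_lookupHV (ρ : MSt) (ν : ℕ) (Hs : List Lit) (hpr : ρ.pr = rbits ν) (hacc : ρ.acc = cbody Hs)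
    (hval : ρ.val = []) (ht1 : ρ.t1 = []) (ht2 : ρ.t2 = []) :
    Runs lookupHV (st ρ) (st { ρ with val := valW Hs ν }) ((12 * (rbits ν).length + 46) * (cbody Hs).length + 10) := by
  unfold lookupHV
  set ρ' : MSt := { ρ with vt := ρ.acc, acc := ρ.vt } with hρ'
  have hrun := runs_lookupV_st ρ' ν Hs (by simp [hρ', hpr]) (by simp [hρ', hacc]) (by simp [hρ', hval])
    (by simp [hρ', ht1]) (by simp [hρ', ht2])
  have hmap := Runs.map (f := (swapVA : Reg → Reg)) swapVA.injective hrun (st ρ) (fun r => st_swapVA ρ r)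
  refine hmap.of_eq ?_ le_rfl
  rw [graft_equiv]
  have hsymm : (swapVA : Reg ≃ Reg).symm = swapVA := by unfold swapVA; exact Equiv.symm_swap _ _
  rw [hsymm]
  funext r
  rw [Function.comp_apply, st_swapVA]

/-! ### Prepending a literal from the probe -/

/-- `pushLit b`: with the reversed index token of `x` in the probe, prepend the literal `(x, b)` to
the assignment `vt` (comma, index bits poured from the probe, value bit). [folklore] -/
def pushLit (b : Bool) : RProg := push (tb TB.vt) Γ'.comma ;; pour (kr KR.pr) (tb TB.vt) ;; push (tb TB.vt) (Γ'.bit b)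

/-- **Specification of `pushLit`**: `pr := []`, `vt := cbody ((x, b) :: L)`. [folklore] -/
theorem runs_pushLit (b : Bool) (ρ : MSt) (x : ℕ) (L : List Lit) (hpr : ρ.pr = rbits x) (hvt : ρ.vt = cbody L) :
    Runs (pushLit b) (st ρ) (st { ρ with pr := [], vt := cbody ((x, b) :: L) }) (3 * (encodeNat x).length + 4) := by
  unfold pushLit
  obtain ⟨inp, out, md, acc, fam, fam2, vt, pr, val, res, clR, cl, fl, done, cy, iu, c, c2, t1, t2⟩ := ρ
  simp only at hpr hvt
  subst hpr; subst hvt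
  have p1 := Runs.push (tb TB.vt) Γ'.comma
    (st ⟨inp, out, md, acc, fam, fam2, cbody L, rbits x, val, res, clR, cl, fl, done, cy, iu, c, c2, t1, t2⟩)
  simp only [st_vt, update_st_vt] at p1
  have p2 := runs_pour (a := kr KR.pr) (b := tb TB.vt) (by decide)
    (st ⟨inp, out, md, acc, fam, fam2, Γ'.comma :: cbody L, rbits x, val, res, clR, cl, fl, done, cy, iu, c, c2, t1, t2⟩)
  simp only [st_pr, st_vt, update_st_pr, update_st_vt] at p2
  have p3 := Runs.push (tb TB.vt) (Γ'.bit b)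
    (st ⟨inp, out, md, acc, fam, fam2, (rbits x).reverse ++ Γ'.comma :: cbody L, [], val, res, clR, cl, fl, done, cy,
      iu, c, c2, t1, t2⟩)
  simp only [st_vt, update_st_vt] at p3
  refine (p1.seq (p2.seq p3)).of_eq ?_ ?_
  · simp [cbody_cons_eq, rbits]
  · simp [rbits]; omega

end Literature.Computability.FineGrained.SchoeningFour
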